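import Summits.CriticalPhenomena.PercolationContinuityZ3.Theses.PercNonProliferation
import Summits.CriticalPhenomena.PercolationContinuityZ3.Theorems.NonProliferation.Negative.AboveSix
import Literature.Barriers.CriticalPhenomena.SpanningClustersAboveSix
import Literature.Probability.Percolation.RussoFormula
import Literature.Probability.Percolation.SharpnessDCTProofs
import Literature.Probability.Percolation.HalfSpaceBGN
import HarnessLib

/-!
# Crux `PercNonProliferation.NonProliferation` (stmt-CriticalPhenomena-4444), line `birth-merge-ledger` — stub `stub_logLedger`

Helper file for the lead's skeleton of line `birth-merge-ledger`
(`Cruxes/NonProliferation/Lines/birth_merge_ledger.lean`, prover-line-stmt-CriticalPhenomena-4444-0).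
Proves exactly the registered stub signature `stub_logLedger`; lands with `--supports stmt-CriticalPhenomena-4444`.

The stub is the calculus glue of the line: with `u(t) = P_t(annulusCrossing d n)`,
`births(t) = Σ_{e ∈ E(B(2n))} P_t(birth_e)`, `merges(t) = Σ_e P_t(merge_e)` and
`meanN(t) = Σ_{k < #B(n)} P_t(repEvent d k n)`, the three hypotheses (the birth–merge ledger
`meanN(b) - meanN(a) = ∫_a^b births - ∫_a^b merges`, the screening inequality
`(1 - u(t)) P_t(birth_e) ≤ P_t(e pivotal for the crossing)` for `t ∈ (0,1)`, and the anchor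
`meanN(0) = 0`, `u(0) = 0`) give `meanN(b) + ∫_0^b merges ≤ -log(1 - u(b))` for `b ∈ [0,1]` with
`u(b) < 1`.  Argument: the annulus crossing is the open crossing event of the finite box `B(2n)`
(definitionally), hence increasing, determined by the pairs of `B(2n)` and measurable; so `u` is
continuous (`continuous_bondPercolation_real_of_determinedBy`), monotone
(`DCT16.real_mono_of_isUpperSet`) and, by the tree's exact Russo formula
(`russo_formula_sum_holds`), differentiable on `(0,1)` with derivative
`U(t) = Σ_{e ∈ B(2n).sym2} P_t(e ∈ E ∧ e pivotal)`.  Summing the screening inequality over the edges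
of `B(2n) ⊆ B(2n).sym2` gives `(1 - u) · births ≤ U` on `(0, b)`, i.e. `births ≤ (-log(1 - u))'`;
the one-sided fundamental theorem of calculus
(`intervalIntegral.integral_le_sub_of_hasDeriv_right_of_le`, which needs integrability of `births`
only — and a non-integrable `births` has integral `0 ≤ -log(1-u(b)) + log(1-u(0))` by monotonicity)
bounds `∫_0^b births` by `log(1 - u(0)) - log(1 - u(b)) = -log(1 - u(b))`, and the ledger at
`a = 0` with the anchor rewrites `meanN(b) + ∫_0^b merges = ∫_0^b births`.  The analytic core is
proved once over abstract real functions (`StubLogLedger.core`).  No published fact is used beyond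
the tree's theorems.
-/

noncomputable section

namespace Summit.CriticalPhenomena.PercolationContinuityZ3.Theorems.NonProliferation

open MeasureTheory Filter Topology
open Literature.Probability.LatticeModels Literature.Probability.Percolation
open Literature.Barriers.CriticalPhenomena
open Summit.CriticalPhenomena.PercolationContinuityZ3.Theorems.NonProliferation.Negative

namespace StubLogLedger

/-! ### Analytic core: `∫_0^b g ≤ log(1 - u 0) - log(1 - u b)` when `(1 - u) g ≤ u'` -/

/-- One-sided fundamental theorem of calculus for `G = -log(1 - u)`: if `u` is continuous on
`[0, b]`, bounded there by `u b < 1`, differentiable on `(0, b)` with derivative `U`, and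
`(1 - u) g ≤ U` on `(0, b)`, then `∫_0^b g ≤ log(1 - u 0) - log(1 - u b)` (for a non-integrable
`g` the integral is `0` and the right-hand side is nonnegative). -/
theorem integral_le_log_sub_log {u U g : ℝ → ℝ} {b : ℝ} (hb : 0 ≤ b)
    (hu : ContinuousOn u (Set.Icc 0 b)) (hle : ∀ t ∈ Set.Icc 0 b, u t ≤ u b) (hub : u b < 1)
    (hderiv : ∀ t ∈ Set.Ioo 0 b, HasDerivAt u (U t) t)
    (hg : ∀ t ∈ Set.Ioo 0 b, (1 - u t) * g t ≤ U t) :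
    ∫ t in (0 : ℝ)..b, g t ≤ Real.log (1 - u 0) - Real.log (1 - u b) := by
  have hpos : ∀ t ∈ Set.Icc 0 b, 0 < 1 - u t := fun t ht => sub_pos.2 ((hle t ht).trans_lt hub)
  by_cases hgi : IntervalIntegrable g volume 0 b
  · have hcont : ContinuousOn (fun t => -Real.log (1 - u t)) (Set.Icc 0 b) :=
      ((continuousOn_const.sub hu).log fun t ht => (hpos t ht).ne').neg
    have hder : ∀ t ∈ Set.Ioo 0 b,
        HasDerivWithinAt (fun t => -Real.log (1 - u t)) (U t / (1 - u t)) (Set.Ioi t) t := by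
      intro t ht
      have h := (((hderiv t ht).const_sub 1).log (hpos t (Set.Ioo_subset_Icc_self ht)).ne').neg
      exact (h.congr_deriv (by rw [neg_div, neg_neg])).hasDerivWithinAt
    have hle' : ∀ t ∈ Set.Ioo 0 b, g t ≤ U t / (1 - u t) := fun t ht => by
      rw [le_div_iff₀ (hpos t (Set.Ioo_subset_Icc_self ht)), mul_comm]
      exact hg t ht
    have h := intervalIntegral.integral_le_sub_of_hasDeriv_right_of_le hb hcont hder
      ((intervalIntegrable_iff_integrableOn_Icc_of_le hb).1 hgi) hle'
    linarith
  · rw [intervalIntegral.integral_undef hgi]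
    exact sub_nonneg.2
      (Real.log_le_log (hpos b ⟨hb, le_rfl⟩) (by linarith [hle 0 ⟨le_rfl, hb⟩]))

/-- The assembled inequality over abstract real functions: the analytic core combined with the
ledger identity at `a = 0` (`M b - M 0 = ∫_0^b g - ∫_0^b m`) and the anchor `M 0 = 0`, `u 0 = 0`
gives `M b + ∫_0^b m ≤ -log(1 - u b)`. -/
theorem core {u U g m M : ℝ → ℝ} {b : ℝ} (hb : 0 ≤ b)
    (hL : M b - M 0 = (∫ t in (0 : ℝ)..b, g t) - ∫ t in (0 : ℝ)..b, m t) (hM0 : M 0 = 0)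
    (hu : ContinuousOn u (Set.Icc 0 b)) (hle : ∀ t ∈ Set.Icc 0 b, u t ≤ u b) (hub : u b < 1)
    (hu0 : u 0 = 0) (hderiv : ∀ t ∈ Set.Ioo 0 b, HasDerivAt u (U t) t)
    (hg : ∀ t ∈ Set.Ioo 0 b, (1 - u t) * g t ≤ U t) :
    M b + ∫ t in (0 : ℝ)..b, m t ≤ -Real.log (1 - u b) := by
  have hint := integral_le_log_sub_log hb hu hle hub hderiv hg
  rw [hu0, sub_zero, Real.log_one, zero_sub] at hint
  rw [hM0, sub_zero] at hL
  linarith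

/-- Summation of a termwise screening inequality: if `c · f e ≤ g e = h e` on `E ⊆ K` and
`h ≥ 0` on `K`, then `c · Σ_{e ∈ E} f e ≤ Σ_{e ∈ K} h e`. -/
theorem sum_screening {ι : Type*} {E K : Finset ι} (hEK : E ⊆ K) {c : ℝ} {f g h : ι → ℝ}
    (hfg : ∀ e ∈ E, c * f e ≤ g e) (hgh : ∀ e ∈ E, g e = h e)
    (hh : ∀ e ∈ K, 0 ≤ h e) :
    c * ∑ e ∈ E, f e ≤ ∑ e ∈ K, h e := by
  rw [Finset.mul_sum]
  calc ∑ e ∈ E, c * f e ≤ ∑ e ∈ E, h e :=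
        Finset.sum_le_sum fun e he => (hfg e he).trans_eq (hgh e he)
    _ ≤ ∑ e ∈ K, h e := Finset.sum_le_sum_of_subset_of_nonneg hEK fun e he _ => hh e he

/-! ### The annulus crossing: increasing, local -/

/-- The annulus-crossing event is the open crossing event of the big box `B(2n)` from the small
box `B(n)` to the inner vertex boundary `∂ⁱⁿB(2n)` (definitional). -/
theorem annulusCrossing_eq_openCrossing (d n : ℕ) :
    annulusCrossing d n = openCrossing (↑(box d (2 * n)) : Set (Site d)) ↑(box d n)
      ↑(innerBoundary (zdGraph d) (box d (2 * n))) := rfl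

/-- The annulus crossing is an increasing event. -/
theorem isUpperSet_annulusCrossing (d n : ℕ) : IsUpperSet (annulusCrossing d n) := by
  rw [annulusCrossing_eq_openCrossing]
  exact isUpperSet_openCrossing _ _ _

/-- The annulus crossing is determined by the pairs of vertices of `B(2n)`. -/
theorem determinedBy_annulusCrossing (d n : ℕ) :
    DeterminedBy (annulusCrossing d n) (↑(box d (2 * n)).sym2 : Set (Sym2 (Site d))) := by
  rw [annulusCrossing_eq_openCrossing]
  exact PlanarDuality.determinedBy_openCrossing _ _ _

end StubLogLedger

/-- **Stub `stub_logLedger`** of line `birth-merge-ledger` (crux stmt-CriticalPhenomena-4444):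
the calculus glue.  Write `P_t` for bond percolation on `ℤ^d` at the clamped parameter `t`,
`u(t) = P_t(annulusCrossing d n)`, `meanN(t) = Σ_{k < #B(n)} P_t(repEvent d k n)` (the mean
number of annulus-spanning clusters), `births(t)`, `merges(t)` for the sums over the edges `e` of
`B(2n)` of the probabilities of the birth and merge events of `e`.  If (ledger)
`meanN(b) - meanN(a) = ∫_a^b births - ∫_a^b merges` for `0 ≤ a ≤ b ≤ 1`, (screening)
`(1 - u(t)) · P_t(birth_e) ≤ P_t(e pivotal for the annulus crossing)` for `t ∈ (0, 1)` and every
edge `e` of `B(2n)`, and (anchor) `P_0(repEvent d k n) = 0` for all `k` and `u(0) = 0` when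
`n ≥ 1`, then for `n ≥ 1`, `b ∈ [0, 1]` with `u(b) < 1`:
`meanN(b) + ∫_0^b merges ≤ -log(1 - u(b))`.  Proof: Russo's formula for the increasing local
event `annulusCrossing d n` and the summed screening inequality give
`births ≤ u'/(1 - u) = (-log(1 - u))'` on `(0, b)`; integrate (one-sided FTC) and use the ledger at
`a = 0` with the anchor (`StubLogLedger.core`). -/
theorem stub_logLedger :
    (∀ (d n : ℕ) (a b : ℝ), 0 ≤ a → a ≤ b → b ≤ 1 → (∑ k ∈ Finset.range (box d n).card, (bondPercolation (zdGraph d) (Set.projIcc (0 : ℝ) 1 zero_le_one b)).real (repEvent d k n)) - (∑ k ∈ Finset.range (box d n).card, (bondPercolation (zdGraph d) (Set.projIcc (0 : ℝ) 1 zero_le_one a)).real (repEvent d k n)) = (∫ t in a..b, ∑ e ∈ edgesIn (zdGraph d) (box d (2 * n)), (bondPercolation (zdGraph d) (Set.projIcc (0 : ℝ) 1 zero_le_one t)).real {ω : BondConfig (Site d) | ∃ x y : Site d, e = s(x, y) ∧ (∃ v ∈ box d n, ω \ {e} ∈ openConnIn (↑(box d (2 * n)) : Set (Site d)) x v) ∧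 (∀ w ∈ innerBoundary (zdGraph d) (box d (2 * n)), ω \ {e} ∉ openConnIn (↑(box d (2 * n)) : Set (Site d)) x w) ∧ (∃ w ∈ innerBoundary (zdGraph d) (box d (2 * n)), ω \ {e} ∈ openConnIn (↑(box d (2 * n)) : Set (Site d)) y w) ∧ (∀ v ∈ box d n, ω \ {e} ∉ openConnIn (↑(box d (2 * n)) : Set (Site d)) y v)}) - ∫ t in a..b, ∑ e ∈ edgesIn (zdGraph d) (box d (2 * n)), (bondPercolation (zdGraph d) (Set.projIcc (0 : ℝ) 1 zero_le_one t)).real {ω : BondConfig (Site d) | ∃ x y : Site d, e = s(x, y) ∧ ω \ {e} ∉ openConnIn (↑(box d (2 * n)) : Set (Site d)) x y ∧ (∃ v ∈ box d n, ω \ {e} ∈ openConnIn (↑(box d (2 * n)) : Set (Site d)) x v) ∧ (∃ w ∈ innerBoundary (zdGraph d) (box d (2 * n)), ω \ {e} ∈ openConnIn (↑(box d (2 * n)) : Set (Site d)) x w) ∧ (∃ v ∈ box d n, ω \ {e} ∈ openConnIn (↑(box d (2 * n)) : Set (Site d)) y v) ∧ (∃ w ∈ innerBoundary (zdGraph d)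 (box d (2 * n)), ω \ {e} ∈ openConnIn (↑(box d (2 * n)) : Set (Site d)) y w)}) → (∀ (d n : ℕ) (t : ℝ), t ∈ Set.Ioo (0 : ℝ) 1 → ∀ e ∈ edgesIn (zdGraph d) (box d (2 * n)), (1 - (bondPercolation (zdGraph d) (Set.projIcc (0 : ℝ) 1 zero_le_one t)).real (annulusCrossing d n)) * (bondPercolation (zdGraph d) (Set.projIcc (0 : ℝ) 1 zero_le_one t)).real {ω : BondConfig (Site d) | ∃ x y : Site d, e = s(x, y) ∧ (∃ v ∈ box d n, ω \ {e} ∈ openConnIn (↑(box d (2 * n)) : Set (Site d)) x v) ∧ (∀ w ∈ innerBoundary (zdGraph d) (box d (2 * n)), ω \ {e} ∉ openConnIn (↑(box d (2 * n)) : Set (Site d)) x w) ∧ (∃ w ∈ innerBoundary (zdGraph d) (box d (2 * n)), ω \ {e} ∈ openConnIn (↑(box d (2 * n)) : Set (Site d)) y w) ∧ (∀ v ∈ box d n, ω \ {e} ∉ openConnIn (↑(box d (2 * n)) : Set (Site d)) y v)} ≤ (bondPercolation (zdGraph d) (Set.projIcc (0 : ℝ) 1 zero_le_one t)).real {ω |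 IsPivotal (annulusCrossing d n) e ω}) → (∀ (d n : ℕ), 1 ≤ n → (∀ k : ℕ, (bondPercolation (zdGraph d) (Set.projIcc (0 : ℝ) 1 zero_le_one 0)).real (repEvent d k n) = 0) ∧ (bondPercolation (zdGraph d) (Set.projIcc (0 : ℝ) 1 zero_le_one 0)).real (annulusCrossing d n) = 0) → ∀ (d n : ℕ) (b : ℝ), 1 ≤ n → 0 ≤ b → b ≤ 1 → (bondPercolation (zdGraph d) (Set.projIcc (0 : ℝ) 1 zero_le_one b)).real (annulusCrossing d n) < 1 → (∑ k ∈ Finset.range (box d n).card, (bondPercolation (zdGraph d) (Set.projIcc (0 : ℝ) 1 zero_le_one b)).real (repEvent d k n)) + (∫ t in (0 : ℝ)..b, ∑ e ∈ edgesIn (zdGraph d) (box d (2 * n)), (bondPercolation (zdGraph d) (Set.projIcc (0 : ℝ) 1 zero_le_one t)).real {ω : BondConfig (Site d) | ∃ x y : Site d, e = s(x, y) ∧ ω \ {e} ∉ openConnIn (↑(box d (2 * n)) : Set (Site d)) x y ∧ (∃ v ∈ box d n, ω \ {e} ∈ openConnIn (↑(box d (2 * n)) : Set (Site d)) x v) ∧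 (∃ w ∈ innerBoundary (zdGraph d) (box d (2 * n)), ω \ {e} ∈ openConnIn (↑(box d (2 * n)) : Set (Site d)) x w) ∧ (∃ v ∈ box d n, ω \ {e} ∈ openConnIn (↑(box d (2 * n)) : Set (Site d)) y v) ∧ (∃ w ∈ innerBoundary (zdGraph d) (box d (2 * n)), ω \ {e} ∈ openConnIn (↑(box d (2 * n)) : Set (Site d)) y w)}) ≤ - Real.log (1 - (bondPercolation (zdGraph d) (Set.projIcc (0 : ℝ) 1 zero_le_one b)).real (annulusCrossing d n)) := by
  intro hL hScr hA d n b hn hb0 hb1 hub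
  obtain ⟨hA1, hA2⟩ := hA d n hn
  have hup := StubLogLedger.isUpperSet_annulusCrossing d n
  have hdet := StubLogLedger.determinedBy_annulusCrossing d n
  have hEK : edgesIn (zdGraph d) (box d (2 * n)) ⊆ (box d (2 * n)).sym2 :=
    fun _ he => (Finset.mem_filter.1 he).2
  -- `M` and `u` are supplied explicitly (their arguments `b`, `0` are not binder patterns)
  refine StubLogLedger.core (b := b)
    (M := fun s => ∑ k ∈ Finset.range (box d n).card,
      (bondPercolation (zdGraph d) (Set.projIcc (0 : ℝ) 1 zero_le_one s)).real (repEvent d k n))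
    (u := fun s => (bondPercolation (zdGraph d) (Set.projIcc (0 : ℝ) 1 zero_le_one s)).real
      (annulusCrossing d n))
    hb0 (hL d n 0 b le_rfl hb0 hb1) (Finset.sum_eq_zero fun k _ => hA1 k)
    ((continuous_bondPercolation_real_of_determinedBy (zdGraph d) hdet).comp
      continuous_projIcc).continuousOn
    (fun t ht => DCT16.real_mono_of_isUpperSet (zdGraph d) hup hdet.measurableSet_of_finset
      (Set.monotone_projIcc zero_le_one ht.2))
    hub hA2
    (fun t ht => russo_formula_sum_holds (zdGraph d) hup _ hdet t ⟨ht.1, ht.2.trans_le hb1⟩)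
    fun t ht => ?_
  refine StubLogLedger.sum_screening hEK (hScr d n t ⟨ht.1, ht.2.trans_le hb1⟩) (fun e he => ?_)
    fun _ _ => measureReal_nonneg
  have he' : e ∈ (zdGraph d).edgeSet := (mem_edgesIn_iff.1 he).1
  congr 1
  ext ω
  exact (and_iff_right he').symm

end Summit.CriticalPhenomena.PercolationContinuityZ3.Theorems.NonProliferation

end
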